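import Mathlib.MeasureTheory.Integral.Bochner.ContinuousLinearMap
import Mathlib.MeasureTheory.Group.Measure

/-!
# T⁴ programme, spine node NE1′ (O3b/H2), COUPLING LINE — the law-side abstract core of «(I) ⇒ L6» of the skeleton
# `t4/skeletons/NE1p-t4-ne1p-p3.md` (v0.8, §3 row L6 / §3b / S5): QUANTITATIVE SCHUR — if the law of the conditioning data is
# `δ`-close to its image under every symmetry (tested on one equivariant statistic), then the mean of that `Ad`-type-EQUIVARIANT
# statistic has norm `≤ δ`; the averaged-projection hypothesis («the group average of the representation kills every vector») is
# discharged from left-invariance of the averaging measure + «no non-zero fixed vector»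

Cell `pub-balaban`, unit `b2b-balaban-t4-ne1p-p3` (ROUND-2 technique-distinct prover #3 on BINDER row NE1′, technique «coupling of
block-spin towers»), generation 30.  OUR elementary lemma (new work ⇒ `Summits/`), Mathlib only; everything is PROVED; nothing is a
`def … : Prop`; nothing of T. Bałaban's series is asserted or cited.  Companion of this lineage's `Support/NE1pEquivariantSchwarz`
(p207071: the EXACT fixed point + analyticity ⇒ linear smallness; here: the APPROXIMATE invariance of the LAW ⇒ smallness of the
mean — the form in which the skeleton's typed estimate (I) `CrossScaleAnisotropy` («the conditional law of the level-`k` fields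
given the unit field differs from its image under every global rotation by at most `δ = c(n+1)(MR_k)²(φⁿ‖F(y)‖ + θ₁ⁿ)` on the
relevant statistics») feeds leaf L6 `EquivariantMeanSuppression`; road P4's slot `StepSupply.contract` is the block-wise
organisation of the same implication).

HONEST FRAMING (T4-DAG p. 1).  Rung (B)+1 on ONE finite four-torus of fixed physical size; NOT infinite volume, NOT a mass gap,
NOT the Clay problem, NOT summit progress.  This file discharges NO estimate about Bałaban's densities: the closeness `δ` is a
HYPOTHESIS here (it is the open estimate (I) ≡ L8); the file only certifies that NOTHING ELSE is needed to pass from (I) to L6.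
HONEST DEPENDENCY (verbatim): continuum YM on T⁴ ⇐ BetaPertH ∧ nine spine estimates (0/9 proved); BetaPertH ⇐ (D1) ∧ (D4) ∧ CAP+tail;
G-an2-4 gates asym, D1 and NE2/3/4.

WHAT IS PROVED ([folklore]).
* `norm_le_of_integral_repr_eq_zero` — QUANTITATIVE SCHUR, vector form: if `∫ π_h m dν(h) = 0` for a probability measure `ν` on
  the symmetry set and `‖m − π_h m‖ ≤ δ` for every `h`, then `‖m‖ ≤ δ`;
* `integral_repr_eq_zero_of_leftInvariant` — the averaged-projection hypothesis from structure: for a LEFT-INVARIANT probability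
  measure `ν` on a group `H` (normalised Haar measure of a compact group — dictionary remark, not constructed here), a
  multiplicative family `π (g*h) = π g ∘ π h` of continuous linear maps and a vector `m` with `h ↦ π_h m` strongly measurable and
  bounded, the average `∫ π_h m dν` is FIXED by every `π_g`, hence `0` when `0` is the only common fixed vector (compact
  semisimple `𝔤` under `Ad`: tree `T4AdInvariant.su2_adInvariant_eq_zero` for `SU(2)`);
* `norm_integral_le_of_equivariant_of_approxInvariant` — THE LAW FORM used by the skeleton: for a law `μ` on the data space `X`,
  an action `σ : H → X → X`, an EQUIVARIANT integrable statistic `f (σ h x) = π h (f x)` and the closeness hypothesis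
  `‖∫ f dμ − ∫ f d(σ_h)_*μ‖ ≤ δ` for every `h` (the dual-metric distance of `μ` to its rotations, tested on `f` only), together with
  the averaged-projection hypothesis for `m = ∫ f dμ`: `‖∫ f dμ‖ ≤ δ`.
NOT PROVED, NOT CLAIMED: any value of `δ` (that is (I)/L8, not in print); the Haar instance on `SU(N)` (Mathlib's `haarMeasure` would
supply `ν`; not needed at this abstraction); anything about Bałaban's conditional laws.
-/

noncomputable section

open MeasureTheory

namespace Summit.QuantumFields.BalabanUV.T4Continuum.NE1pApproximateSchur

variable {E : Type*} [NormedAddCommGroup E] [NormedSpace ℝ E] [CompleteSpace E]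
variable {H : Type*} [MeasurableSpace H]

/-- **QUANTITATIVE SCHUR, vector form.**  If the `ν`-average of the transforms `π_h m` vanishes (`ν` a probability measure on the
symmetry set) and every transform moves `m` by at most `δ`, then `‖m‖ ≤ δ`: `m = ∫ (m − π_h m) dν`. [folklore] -/
theorem norm_le_of_integral_repr_eq_zero (ν : Measure H) [IsProbabilityMeasure ν] (π : H → E →L[ℝ] E) (m : E)
    (hmeas : AEStronglyMeasurable (fun h => π h m) ν) (hproj : ∫ h, π h m ∂ν = 0) {δ : ℝ}
    (hδ : ∀ h, ‖m - π h m‖ ≤ δ) : ‖m‖ ≤ δ := by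
  have hint : Integrable (fun h => π h m) ν := by
    refine (integrable_const (‖m‖ + δ)).mono' hmeas (Filter.Eventually.of_forall fun h => ?_)
    have h1 : ‖π h m‖ ≤ ‖m‖ + ‖m - π h m‖ := by
      have := norm_sub_le m (m - π h m)
      rwa [sub_sub_cancel] at this
    exact h1.trans (add_le_add le_rfl (hδ h))
  have e : m = ∫ h, (m - π h m) ∂ν := by
    rw [integral_sub (integrable_const m) hint, hproj, sub_zero, integral_const, probReal_univ, one_smul]
  rw [e]
  have h := norm_integral_le_of_norm_le_const (μ := ν) (f := fun h => m - π h m) (C := δ)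
    (Filter.Eventually.of_forall hδ)
  rwa [probReal_univ, mul_one] at h

/-- **THE AVERAGED PROJECTION VANISHES** from structure: for a left-invariant probability measure `ν` on a group `H`, a
multiplicative family `π` and a vector `m` with `h ↦ π_h m` strongly measurable and bounded, the average `∫ π_h m dν` is fixed by
every `π_g` (left invariance), hence zero when `0` is the only common fixed vector. [folklore] -/
theorem integral_repr_eq_zero_of_leftInvariant [Group H] [MeasurableMul H] (ν : Measure H) [IsProbabilityMeasure ν]
    [ν.IsMulLeftInvariant] (π : H → E →L[ℝ] E) (hmul : ∀ g h, π (g * h) = (π g).comp (π h))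
    (hfix : ∀ v : E, (∀ g, π g v = v) → v = 0) (m : E) (hmeas : AEStronglyMeasurable (fun h => π h m) ν)
    {C : ℝ} (hbdd : ∀ h, ‖π h m‖ ≤ C) : ∫ h, π h m ∂ν = 0 := by
  have hint : Integrable (fun h => π h m) ν :=
    (integrable_const C).mono' hmeas (Filter.Eventually.of_forall hbdd)
  refine hfix _ fun g => ?_
  have hmap : ν.map (g * ·) = ν := map_mul_left_eq_self ν g
  calc π g (∫ h, π h m ∂ν) = ∫ h, π g (π h m) ∂ν := ((π g).integral_comp_comm hint).symm
    _ = ∫ h, π (g * h) m ∂ν := by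
        refine integral_congr_ae (Filter.Eventually.of_forall fun h => ?_)
        simp [hmul g h]
    _ = ∫ h, π h m ∂(ν.map (g * ·)) :=
        (integral_map (measurable_const_mul g).aemeasurable (by rw [hmap]; exact hmeas)).symm
    _ = ∫ h, π h m ∂ν := by rw [hmap]

variable {X : Type*} [MeasurableSpace X]

/-- **QUANTITATIVE SCHUR, law form** (the abstract core of «(I) `CrossScaleAnisotropy` ⇒ L6 `EquivariantMeanSuppression`»).  For a
law `μ` on the data space, an action `σ` of the symmetry set by measurable maps, an EQUIVARIANT integrable statistic
(`f (σ h x) = π h (f x)`) whose mean has vanishing averaged projection, and the closeness of `μ` to each rotated law `(σ_h)_*μ`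
TESTED ON `f` — `‖∫ f dμ − ∫ f d(σ_h)_*μ‖ ≤ δ` — the mean is small: `‖∫ f dμ‖ ≤ δ`. [folklore] -/
theorem norm_integral_le_of_equivariant_of_approxInvariant (μ : Measure X) (ν : Measure H) [IsProbabilityMeasure ν]
    (σ : H → X → X) (hσ : ∀ h, Measurable (σ h)) (π : H → E →L[ℝ] E) {f : X → E} (hf : Integrable f μ)
    (hfmeas : ∀ h, AEStronglyMeasurable f (μ.map (σ h))) (hequiv : ∀ h x, f (σ h x) = π h (f x))
    (hmeas : AEStronglyMeasurable (fun h => π h (∫ x, f x ∂μ)) ν) (hproj : ∫ h, π h (∫ x, f x ∂μ) ∂ν = 0) {δ : ℝ}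
    (hδ : ∀ h, ‖(∫ x, f x ∂μ) - ∫ x, f x ∂(μ.map (σ h))‖ ≤ δ) :
    ‖∫ x, f x ∂μ‖ ≤ δ := by
  refine norm_le_of_integral_repr_eq_zero ν π (∫ x, f x ∂μ) hmeas hproj fun h => ?_
  have e : π h (∫ x, f x ∂μ) = ∫ x, f x ∂(μ.map (σ h)) := by
    rw [← (π h).integral_comp_comm hf, integral_map (hσ h).aemeasurable (hfmeas h)]
    exact integral_congr_ae (Filter.Eventually.of_forall fun x => (hequiv h x).symm)
  rw [e]
  exact hδ h

end Summit.QuantumFields.BalabanUV.T4Continuum.NE1pApproximateSchur
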